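import Mathlib
import Literature.NumberTheory.LFunctions.Zhang2022.Section10Range1113Profiles
import Literature.NumberTheory.LFunctions.Zhang2022.Section10Range1321SecondLines
import Literature.NumberTheory.LFunctions.Zhang2022.SkeletonWindowPowers
import HarnessLib

/-!
# Zhang (2022) §10b: the three "second lines" of the evaluation of `Θ₁(𝐚₁₁,𝐚₁₃)` —
# DAG nodes Z22:§10.u036 (ii), Z22:§10.u037 (ii), Z22:§10.u038 (ii), PROVED OUTRIGHT

Topic `Literature/NumberTheory/LFunctions/Zhang2022` (Landau–Siegel audit tree; verdict-neutral).
Y. Zhang, *Discrete mean estimates and the Landau–Siegel zero*, arXiv:2211.02515v1 (2022)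
[Zhang2022LandauSiegel], §10 p. 57 (the three displays of the evaluation of `Θ₁(𝐚₁₁,𝐚₁₃)` before
(10.12), each "first line → second line") — **an unrefereed manuscript under adjudication; this file
asserts nothing about its Theorems 1–2 or about Landau–Siegel zeros.** ZHANG-L discharge lane
(WP10, seat zl-w10-p3), leaf `Typed.Sec10B.Concl1113` of `Skeleton.theorem1_of_leaves_v19`
(consumer: `Typed.Sec10B.concl1113_of`, `Section10ConeAssembly`).

What is PROVED here (kernel-checked, theorem-only, no new definitions or facts):

* `eq1037b_holds : Eq1037b c′` — **Z22:§10.u037 (ii) HOLDS as typed**: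
  "`… = (500𝔞/(0.504 log P))∫_{0.5}^{0.502} 𝔣𝔣_{j6}(0.504 − z)(−1 + 𝔶𝔶₁ⱼ(z))dz + o(α)`";
* `eq1038b_holds : Eq1038b c′` — **Z22:§10.u038 (ii) HOLDS as typed**:
  "`… = (500𝔞/(0.504 log P))∫_{0.502}^{0.504} 𝔣𝔣_{j6}(0.504 − z)(1 + 𝔶𝔶₂ⱼ(z))dz + o(α)`";
* `eq1036b_holds : Eq1036b c′` — **Z22:§10.u036 (ii) HOLDS as typed**:
  "`… = (𝔞β_{j+1}β_{j+2}/500)∫_1^{P^{0.5}}(𝔣_{j6}(P^{0.504}/x)/0.504 + ι₂𝔣_{j7}(P^{0.5}/x)/0.5)dx/x + o(α)`".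

Engines (tree theorems): `Typed.Sec10C.lamAvg_second_line` (sz-d39, unconditional "second line"),
`Typed.Sec10C.lamAvg_rule` (sz-d34, "the results in Section 8": `λ₀ⱼ(n) = φ(n)²/n² + O(α𝓛)`, the
weak mean value of `Σ|χ(n)|φ(n)/n²`, partial summation), the bridge `nAvg = lamAvg`
(`Typed.Sec10B.nAvg_eq_lamAvg`, `Section10Range1321SecondLines`), the profiles of
`Section10Range1113Profiles`, the main values `𝔣_{j6}(P^w) = 𝔣𝔣_{j6}(w) + O(𝓛⁻⁸)`
(`Typed.Sec10C.norm_frakf_sub_ffJ`) and `𝔶_{1,2;j}(P^z) = 𝔶𝔶_{1,2;j}(z) + O(𝓛⁻⁸)`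
(`Typed.Sec10A.step10u024_holds`, Z22:§10.u024 — the only place (A) enters, as that node is typed
under (A)); `𝔞 = 𝔠_D L′(1,χ)²` (`RangeAverage.frakA_eq_frakcD_mul_sq`), `|L′(1,χ)| ≤ 4e^{9/2}𝓛²`.

## References

* Y. Zhang, arXiv:2211.02515v1 (2022), §10 p. 57; §8 p. 48–49; §2 (2.13), (2.26), (2.31).
  [cite: Zhang2022LandauSiegel, §10 p. 57]
-/

noncomputable section

open Complex Real ComplexConjugate MeasureTheory
open Literature.NumberTheory.LFunctions.Zhang2022.Skeleton

namespace Literature.NumberTheory.LFunctions.Zhang2022.Typed.Sec10B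

section SecondLines1113

/-! ### Z22:§10.u037 (ii) and Z22:§10.u038 (ii): the `z`-form via `lamAvg_second_line` -/

/-- **Z22:§10.u037 (ii) HOLDS** [Z22 p.57, tex L2932, second line]: `Eq1037b c′` — for every `ε > 0`,
all large `D`, every real primitive `χ (mod D)` with (A) and `j ∈ {1,2,3}`,
`‖(500L′(1,χ)²/(0.504 log²P))Σ_{P^{0.5}≤n<P^{0.502}}|χ(n)|λ₀ⱼ(n)φ(n)⁻¹𝔣_{j6}(P^{0.504}/n)(−1 + 𝔶₁ⱼ(n))
− (500𝔞/(0.504 log P))∫_{0.5}^{0.502}𝔣𝔣_{j6}(0.504 − z)(−1 + 𝔶𝔶₁ⱼ(z))dz‖ ≤ εα`. Proof: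
`lamAvg_second_line` with `κ = 500/0.504`, the window `[P^{0.5}, P^{0.502}]`, the profile
`𝔣_{j6}(P^{0.504}/t)(−1 + 𝔶₁ⱼ(t))` (`mid1113Profile_bounds`) and the main values
`𝔣𝔣_{j6}(0.504 − z)(−1 + 𝔶𝔶₁ⱼ(z))` (`norm_frakf_sub_ffJ`; `step10u024_holds`, Z22:§10.u024);
error `O_{c′}(𝓛⁻¹²) = o(α)`. [cite: Zhang2022LandauSiegel, §10 p. 57, tex L2932] -/
theorem eq1037b_holds (c' : ℝ) : Eq1037b c' := by
  intro ε hε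
  obtain ⟨C₂₄, h24⟩ := Sec10A.step10u024_holds c'
  set C₀ : ℝ := 417 * (5 * π ^ 2 * |c'|) + 6 * |C₂₄| with hC₀
  have hC₀0 : 0 ≤ C₀ := by positivity
  have hgen := Sec10C.lamAvg_second_line c' ((500 : ℂ) / 0.504) (a := 0.5) (b := 0.502)
    (M := 12093) (M' := 44998) (C₀ := C₀) (by norm_num) (by norm_num) (by norm_num) (by norm_num)
    (by norm_num) hC₀0 ε hε
  have h5 := Sec10C.forAllLarge_ell_six (5 * c')
  refine ((hgen.and h24).and h5).mono ?_
  intro D _ χ hq hp ⟨⟨hG, h24D⟩, hℓ6, hc5⟩ hA j hj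
  obtain ⟨hℓ0, hP1, hΛ, hα, hαℓ, hΛ4, hc, hQ1⟩ := basic_facts_of_ell_six hℓ6 hc5
  have hP : 0 < bigP D := Real.exp_pos _
  have hhiP : bigP D ^ (0.502 : ℝ) + 1 ≤ bigP D :=
    Sec10C.rpow_add_one_le_bigP (by norm_num) (by norm_num) (by linarith) (by nlinarith)
  -- the profile and its main value
  set F : ℝ → ℂ := fun t => frakfW c' D j 6 (bigP D ^ (0.504 : ℝ) / t) *
    (-1 + fraky1 c' D j t) with hF
  set G₀ : ℝ → ℂ := fun z => ffSel j 6 (0.504 - z) * (-1 + yy1Sel j z) with hG₀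
  have hprof : ∀ t : ℝ, bigP D ^ (0.5 : ℝ) ≤ t → t ≤ bigP D ^ (0.502 : ℝ) + 1 →
      DifferentiableAt ℝ F t ∧ ‖F t‖ ≤ 12093 ∧ ‖deriv F t‖ ≤ 44998 * alpha D / t := by
    intro t h1 h2
    exact mid1113Profile_bounds c' j hα hℓ0.le hc (hQ1.trans h1) (h2.trans hhiP) hΛ4
  have hG₀i : IntervalIntegrable G₀ volume (0.5 : ℝ) 0.502 := by
    apply Continuous.intervalIntegrable
    rw [hG₀]
    simp only [ffSel_six, yy1Sel_eq_yyJ1]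
    fun_prop
  have happrox : ∀ z ∈ Set.Icc (0.5 : ℝ) 0.502, ‖F (bigP D ^ z) - G₀ z‖ ≤ C₀ / ell D ^ 8 := by
    intro z hz
    obtain ⟨hz1, hz2⟩ := hz
    set f : ℂ := frakfW c' D j 6 (bigP D ^ (0.504 : ℝ) / bigP D ^ z) with hf
    set y : ℂ := -1 + fraky1 c' D j (bigP D ^ z) with hy
    set f₀ : ℂ := ffSel j 6 (0.504 - z) with hf₀
    set y₀ : ℂ := -1 + yy1Sel j z with hy₀
    have eF : F (bigP D ^ z) - G₀ z = (f - f₀) * y + f₀ * (y - y₀) := by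
      simp only [hF, hG₀, hf, hy, hf₀, hy₀]; ring
    have hw : |(0.504 : ℝ) - z| ≤ 1 := by rw [abs_le]; constructor <;> linarith
    -- `‖f − f₀‖ ≤ 5π²|c′|𝓛⁻⁸`
    have hff : ‖f - f₀‖ ≤ 5 * π ^ 2 * |c'| / ell D ^ 8 := by
      rw [hf, hf₀, frakfW6_at_rpow504, ffSel_six]
      refine (Sec10C.norm_frakf_sub_ffJ (c' := c') hΛ hj (0.504 - z)).1.trans ?_
      have hu : |c' * alpha D * ell D| = |c'| * (π / ell D ^ 8) := by
        rw [mul_assoc, abs_mul, hαℓ, abs_of_pos (show (0:ℝ) < π / ell D ^ 8 by positivity)]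
      rw [hu]
      calc 5 * π * (|c'| * (π / ell D ^ 8)) * |(0.504 : ℝ) - z|
          ≤ 5 * π * (|c'| * (π / ell D ^ 8)) * 1 := by gcongr
        _ = 5 * π ^ 2 * |c'| / ell D ^ 8 := by ring
    -- `‖y‖ ≤ 417`
    have hyn : ‖y‖ ≤ 417 := by
      have hPz1 : 1 ≤ bigP D ^ z := Real.one_le_rpow hP1.le (by linarith)
      have hPzP : bigP D ^ z ≤ bigP D := by
        calc bigP D ^ z ≤ bigP D ^ (1 : ℝ) := Real.rpow_le_rpow_of_exponent_le hP1.le (by linarith)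
          _ = bigP D := Real.rpow_one _
      exact (y1ProfileU_bounds c' j hα hℓ0.le hc hPz1 hPzP hΛ4).2.1
    -- `‖f₀‖ ≤ 6`
    have hf₀n : ‖f₀‖ ≤ 6 := by rw [hf₀, ffSel_six]; exact Sec10C.norm_ffJ6_le j hw
    -- `‖y − y₀‖ ≤ |C₂₄|𝓛⁻⁸` (Z22:§10.u024 at `w = z`)
    have hyy : ‖y - y₀‖ ≤ |C₂₄| / ell D ^ 8 := by
      have h := (h24D hA j hj z (by linarith) (by linarith)).1
      have ey : y - y₀ = fraky1 c' D j (bigP D ^ z) -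
          (if j = 1 then yy11 z else if j = 2 then yy12 z else yy13 z) := by
        rw [hy, hy₀, yy1Sel_apply]; ring
      rw [ey]
      refine h.trans ?_
      rw [← div_eq_mul_inv]
      gcongr
      exact le_abs_self _
    rw [eF]
    calc ‖(f - f₀) * y + f₀ * (y - y₀)‖ ≤ ‖f - f₀‖ * ‖y‖ + ‖f₀‖ * ‖y - y₀‖ := by
          refine (norm_add_le _ _).trans ?_; rw [norm_mul, norm_mul]
      _ ≤ 5 * π ^ 2 * |c'| / ell D ^ 8 * 417 + 6 * (|C₂₄| / ell D ^ 8) :=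
          add_le_add (mul_le_mul hff hyn (norm_nonneg _) (by positivity))
            (mul_le_mul hf₀n hyy (norm_nonneg _) (by norm_num))
      _ = C₀ / ell D ^ 8 := by rw [hC₀]; ring
  -- the engine
  have key := hG j F G₀ hprof hG₀i happrox
  have hN : nAvg c' χ j (bigP D ^ (0.5 : ℝ)) (bigP D ^ (0.502 : ℝ))
      (fun n => frakfW c' D j 6 (bigP D ^ (0.504 : ℝ) / n) * (-1 + fraky1 c' D j n)) =
      Sec10C.lamAvg c' χ j (bigP D ^ (0.5 : ℝ)) (bigP D ^ (0.502 : ℝ)) (fun n => F n) := by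
    rw [nAvg_eq_lamAvg c' χ j (by linarith : (0 : ℝ) < bigP D ^ (0.5 : ℝ))]
  have hI : ∫ z in (0.5 : ℝ)..0.502, ffSel j 6 (0.504 - z) * (-1 + yy1Sel j z) =
      ∫ z in (0.5 : ℝ)..0.502, G₀ z := by simp only [hG₀]
  rw [hN, hI]
  have e : (500 : ℂ) * deriv χ.LFunction 1 ^ 2 / (0.504 * (logP D : ℂ) ^ 2) *
        Sec10C.lamAvg c' χ j (bigP D ^ (0.5 : ℝ)) (bigP D ^ (0.502 : ℝ)) (fun n => F n) -
      500 * (frakA χ : ℂ) / (0.504 * (logP D : ℂ)) * ∫ z in (0.5 : ℝ)..0.502, G₀ z =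
      (500 : ℂ) / 0.504 * deriv χ.LFunction 1 ^ 2 / (Real.log (bigP D) : ℂ) ^ 2 *
        Sec10C.lamAvg c' χ j (bigP D ^ (0.5 : ℝ)) (bigP D ^ (0.502 : ℝ)) (fun n => F n) -
      (500 : ℂ) / 0.504 * (frakA χ : ℂ) / (Real.log (bigP D) : ℂ) *
        ∫ z in (0.5 : ℝ)..0.502, G₀ z := by
    simp only [logP]
    ring
  rw [e]
  exact key

variable (c' : ℝ) in
/-- `Eq1037b` — `_holds` alias of `eq1037b_holds` above under the fact's exact name, stated under the
prover's own binders as section variables (appended 2026-08-28, D-0026 bookkeeping: the proof term is the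
existing theorem of this file; no statement, definition or attribute is edited; no new named fact; the
ledger's debt table listed the fact unproved). [cite: Zhang2022LandauSiegel, §10 p. 57, tex L2932] -/
theorem _root_.Literature.NumberTheory.LFunctions.Zhang2022.Typed.Sec10B.Eq1037b_holds :
    _root_.Literature.NumberTheory.LFunctions.Zhang2022.Typed.Sec10B.Eq1037b c' :=
  _root_.Literature.NumberTheory.LFunctions.Zhang2022.Typed.Sec10B.eq1037b_holds (c' := c')

/-- **Z22:§10.u038 (ii) HOLDS** [Z22 p.57, tex L2942, second line]: `Eq1038b c′` — for every `ε > 0`,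
all large `D`, every real primitive `χ (mod D)` with (A) and `j ∈ {1,2,3}`,
`‖(500L′(1,χ)²/(0.504 log²P))Σ_{P^{0.502}≤n<P^{0.504}}|χ(n)|λ₀ⱼ(n)φ(n)⁻¹𝔣_{j6}(P^{0.504}/n)(1 + 𝔶₂ⱼ(n))
− (500𝔞/(0.504 log P))∫_{0.502}^{0.504}𝔣𝔣_{j6}(0.504 − z)(1 + 𝔶𝔶₂ⱼ(z))dz‖ ≤ εα`. Proof:
`lamAvg_second_line` with `κ = 500/0.504`, the window `[P^{0.502}, P^{0.504}]`, the profile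
`𝔣_{j6}(P^{0.504}/t)(1 + 𝔶₂ⱼ(t))` (`top1113Profile_bounds`) and the main values
`𝔣𝔣_{j6}(0.504 − z)(1 + 𝔶𝔶₂ⱼ(z))`; error `O_{c′}(𝓛⁻¹²) = o(α)`.
[cite: Zhang2022LandauSiegel, §10 p. 57, tex L2942] -/
theorem eq1038b_holds (c' : ℝ) : Eq1038b c' := by
  intro ε hε
  obtain ⟨C₂₄, h24⟩ := Sec10A.step10u024_holds c'
  set C₀ : ℝ := 161 * (5 * π ^ 2 * |c'|) + 6 * |C₂₄| with hC₀
  have hC₀0 : 0 ≤ C₀ := by positivity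
  have hgen := Sec10C.lamAvg_second_line c' ((500 : ℂ) / 0.504) (a := 0.502) (b := 0.504)
    (M := 4669) (M' := 17222) (C₀ := C₀) (by norm_num) (by norm_num) (by norm_num) (by norm_num)
    (by norm_num) hC₀0 ε hε
  have h5 := Sec10C.forAllLarge_ell_six (5 * c')
  refine ((hgen.and h24).and h5).mono ?_
  intro D _ χ hq hp ⟨⟨hG, h24D⟩, hℓ6, hc5⟩ hA j hj
  obtain ⟨hℓ0, hP1, hΛ, hα, hαℓ, hΛ4, hc, hQ1⟩ := basic_facts_of_ell_six hℓ6 hc5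
  have hP : 0 < bigP D := Real.exp_pos _
  have hlo1 : 1 ≤ bigP D ^ (0.502 : ℝ) := Real.one_le_rpow hP1.le (by norm_num)
  have hhiP : bigP D ^ (0.504 : ℝ) + 1 ≤ bigP D :=
    Sec10C.rpow_add_one_le_bigP (by norm_num) (by norm_num) (by linarith) (by nlinarith)
  -- the profile and its main value
  set F : ℝ → ℂ := fun t => frakfW c' D j 6 (bigP D ^ (0.504 : ℝ) / t) *
    (1 + fraky2 c' D j t) with hF
  set G₀ : ℝ → ℂ := fun z => ffSel j 6 (0.504 - z) * (1 + yy2Sel j z) with hG₀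
  have hprof : ∀ t : ℝ, bigP D ^ (0.502 : ℝ) ≤ t → t ≤ bigP D ^ (0.504 : ℝ) + 1 →
      DifferentiableAt ℝ F t ∧ ‖F t‖ ≤ 4669 ∧ ‖deriv F t‖ ≤ 17222 * alpha D / t := by
    intro t h1 h2
    exact top1113Profile_bounds c' j hα hℓ0.le hc (hlo1.trans h1) (h2.trans hhiP) hΛ4
  have hG₀i : IntervalIntegrable G₀ volume (0.502 : ℝ) 0.504 := by
    apply Continuous.intervalIntegrable
    rw [hG₀]
    simp only [ffSel_six, yy2Sel_eq_yyJ2]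
    fun_prop
  have happrox : ∀ z ∈ Set.Icc (0.502 : ℝ) 0.504, ‖F (bigP D ^ z) - G₀ z‖ ≤ C₀ / ell D ^ 8 := by
    intro z hz
    obtain ⟨hz1, hz2⟩ := hz
    set f : ℂ := frakfW c' D j 6 (bigP D ^ (0.504 : ℝ) / bigP D ^ z) with hf
    set y : ℂ := 1 + fraky2 c' D j (bigP D ^ z) with hy
    set f₀ : ℂ := ffSel j 6 (0.504 - z) with hf₀
    set y₀ : ℂ := 1 + yy2Sel j z with hy₀
    have eF : F (bigP D ^ z) - G₀ z = (f - f₀) * y + f₀ * (y - y₀) := by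
      simp only [hF, hG₀, hf, hy, hf₀, hy₀]; ring
    have hw : |(0.504 : ℝ) - z| ≤ 1 := by rw [abs_le]; constructor <;> linarith
    have hff : ‖f - f₀‖ ≤ 5 * π ^ 2 * |c'| / ell D ^ 8 := by
      rw [hf, hf₀, frakfW6_at_rpow504, ffSel_six]
      refine (Sec10C.norm_frakf_sub_ffJ (c' := c') hΛ hj (0.504 - z)).1.trans ?_
      have hu : |c' * alpha D * ell D| = |c'| * (π / ell D ^ 8) := by
        rw [mul_assoc, abs_mul, hαℓ, abs_of_pos (show (0:ℝ) < π / ell D ^ 8 by positivity)]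
      rw [hu]
      calc 5 * π * (|c'| * (π / ell D ^ 8)) * |(0.504 : ℝ) - z|
          ≤ 5 * π * (|c'| * (π / ell D ^ 8)) * 1 := by gcongr
        _ = 5 * π ^ 2 * |c'| / ell D ^ 8 := by ring
    have hyn : ‖y‖ ≤ 161 := by
      have hPz1 : 1 ≤ bigP D ^ z := Real.one_le_rpow hP1.le (by linarith)
      have hPzP : bigP D ^ z ≤ bigP D := by
        calc bigP D ^ z ≤ bigP D ^ (1 : ℝ) := Real.rpow_le_rpow_of_exponent_le hP1.le (by linarith)
          _ = bigP D := Real.rpow_one _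
      exact (y2ProfileU_bounds c' j hα hℓ0.le hc hPz1 hPzP hΛ4).2.1
    have hf₀n : ‖f₀‖ ≤ 6 := by rw [hf₀, ffSel_six]; exact Sec10C.norm_ffJ6_le j hw
    have hyy : ‖y - y₀‖ ≤ |C₂₄| / ell D ^ 8 := by
      have h := (h24D hA j hj z (by linarith) (by linarith)).2
      have ey : y - y₀ = fraky2 c' D j (bigP D ^ z) -
          (if j = 1 then yy21 z else if j = 2 then yy22 z else yy23 z) := by
        rw [hy, hy₀, yy2Sel_apply]; ring
      rw [ey]
      refine h.trans ?_
      rw [← div_eq_mul_inv]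
      gcongr
      exact le_abs_self _
    rw [eF]
    calc ‖(f - f₀) * y + f₀ * (y - y₀)‖ ≤ ‖f - f₀‖ * ‖y‖ + ‖f₀‖ * ‖y - y₀‖ := by
          refine (norm_add_le _ _).trans ?_; rw [norm_mul, norm_mul]
      _ ≤ 5 * π ^ 2 * |c'| / ell D ^ 8 * 161 + 6 * (|C₂₄| / ell D ^ 8) :=
          add_le_add (mul_le_mul hff hyn (norm_nonneg _) (by positivity))
            (mul_le_mul hf₀n hyy (norm_nonneg _) (by norm_num))
      _ = C₀ / ell D ^ 8 := by rw [hC₀]; ring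
  -- the engine
  have key := hG j F G₀ hprof hG₀i happrox
  have hN : nAvg c' χ j (bigP D ^ (0.502 : ℝ)) (bigP D ^ (0.504 : ℝ))
      (fun n => frakfW c' D j 6 (bigP D ^ (0.504 : ℝ) / n) * (1 + fraky2 c' D j n)) =
      Sec10C.lamAvg c' χ j (bigP D ^ (0.502 : ℝ)) (bigP D ^ (0.504 : ℝ)) (fun n => F n) := by
    rw [nAvg_eq_lamAvg c' χ j (by linarith : (0 : ℝ) < bigP D ^ (0.502 : ℝ))]
  have hI : ∫ z in (0.502 : ℝ)..0.504, ffSel j 6 (0.504 - z) * (1 + yy2Sel j z) =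
      ∫ z in (0.502 : ℝ)..0.504, G₀ z := by simp only [hG₀]
  rw [hN, hI]
  have e : (500 : ℂ) * deriv χ.LFunction 1 ^ 2 / (0.504 * (logP D : ℂ) ^ 2) *
        Sec10C.lamAvg c' χ j (bigP D ^ (0.502 : ℝ)) (bigP D ^ (0.504 : ℝ)) (fun n => F n) -
      500 * (frakA χ : ℂ) / (0.504 * (logP D : ℂ)) * ∫ z in (0.502 : ℝ)..0.504, G₀ z =
      (500 : ℂ) / 0.504 * deriv χ.LFunction 1 ^ 2 / (Real.log (bigP D) : ℂ) ^ 2 *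
        Sec10C.lamAvg c' χ j (bigP D ^ (0.502 : ℝ)) (bigP D ^ (0.504 : ℝ)) (fun n => F n) -
      (500 : ℂ) / 0.504 * (frakA χ : ℂ) / (Real.log (bigP D) : ℂ) *
        ∫ z in (0.502 : ℝ)..0.504, G₀ z := by
    simp only [logP]
    ring
  rw [e]
  exact key

variable (c' : ℝ) in
/-- `Eq1038b` — `_holds` alias of `eq1038b_holds` above under the fact's exact name, stated under the
prover's own binders as section variables (appended 2026-08-28, D-0026 bookkeeping: the proof term is the
existing theorem of this file; no statement, definition or attribute is edited; no new named fact; the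
ledger's debt table listed the fact unproved). [cite: Zhang2022LandauSiegel, §10 p. 57, tex L2942] -/
theorem _root_.Literature.NumberTheory.LFunctions.Zhang2022.Typed.Sec10B.Eq1038b_holds :
    _root_.Literature.NumberTheory.LFunctions.Zhang2022.Typed.Sec10B.Eq1038b c' :=
  _root_.Literature.NumberTheory.LFunctions.Zhang2022.Typed.Sec10B.eq1038b_holds (c' := c')

/-! ### Z22:§10.u036 (ii): the low range, `X`-form via `lamAvg_rule` -/

/-- **Z22:§10.u036 (ii) HOLDS** [Z22 p.57, tex L2921, second line]: `Eq1036b c′` — for every `ε > 0`,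
all large `D`, every real primitive `χ (mod D)` with (A) and `j ∈ {1,2,3}`,
`‖(L′(1,χ)²/500)β_{j+1}β_{j+2}Σ_{n<P^{0.5}}|χ(n)|λ₀ⱼ(n)φ(n)⁻¹G(n) − (𝔞β_{j+1}β_{j+2}/500)∫_1^{P^{0.5}}G(x)dx/x‖ ≤ εα`,
`G(x) = 𝔣_{j6}(P^{0.504}/x)/0.504 + ι₂𝔣_{j7}(P^{0.5}/x)/0.5`. Proof: the evaluation rule `lamAvg_rule`
("the results in Section 8") on `[1, P^{0.5}]` with the `C¹` profile `G` (`low1113Profile_bounds`),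
`𝔞 = 𝔠_D L′(1,χ)²`, `|L′(1,χ)| ≤ 4e^{9/2}𝓛²`, `|β_{j+1}β_{j+2}| ≤ 16α²`: total error
`O((1+|ι₂|)C₀𝓛⁶α²) = o(α)`. ((A) is not used.) [cite: Zhang2022LandauSiegel, §10 p. 57, tex L2921] -/
theorem eq1036b_holds (c' : ℝ) : Eq1036b c' := by
  intro ε hε
  obtain ⟨C₀, hC₀0, hrule⟩ := Sec10C.lamAvg_rule c'
  set cL : ℝ := 4 * Real.exp (9 / 2) with hcL
  set Kι : ℝ := 1 + ‖iota2‖ with hKι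
  have hKι0 : 0 ≤ Kι := by positivity
  -- total error `≤ (16/500)·cL²𝓛⁴·C₀𝓛²·Kι(58 + 188·4)·α² = K·α·(α𝓛⁶)`, `α𝓛⁶ = π/𝓛³`
  set K : ℝ := 16 / 500 * cL ^ 2 * C₀ * (Kι * (58 + 188 * 4)) with hK
  have hK0 : 0 ≤ K := by positivity
  have h5 := Sec10C.forAllLarge_ell_six (5 * c')
  obtain ⟨D₁, hD₁⟩ := exists_nat_forall_le_ell (K * π / ε + 1)
  have hL : ForAllLarge fun D _ _ => K * π / ε + 1 ≤ ell D := ⟨D₁, fun D _ _ hD _ _ => hD₁ D hD⟩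
  refine ((hrule.and h5).and hL).mono ?_
  intro D _ χ hq hp ⟨⟨hR, hℓ6, hc5⟩, hℓK⟩ hA j hj
  obtain ⟨hℓ0, hP1, hΛ, hα, hαℓ, hΛ4, hc, hQ1⟩ := basic_facts_of_ell_six hℓ6 hc5
  have hℓ1 : 1 ≤ ell D := by linarith
  have hℓ3 : 3 ≤ ell D := by linarith
  have hP : 0 < bigP D := Real.exp_pos _
  have hlogP : Real.log (bigP D) = ell D ^ 9 := by rw [bigP, Real.log_exp]
  have hαdef : alpha D = π / ell D ^ 9 := by rw [alpha, hlogP]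
  have hhiP : bigP D ^ (0.5 : ℝ) + 1 ≤ bigP D :=
    Sec10C.rpow_add_one_le_bigP (by norm_num) (by norm_num) hℓ1 (by nlinarith)
  have hD2 : 2 ≤ D := by
    by_contra h
    have hD1 : (D : ℝ) ≤ 1 := by exact_mod_cast (by omega : D ≤ 1)
    have : ell D ≤ 0 := by
      rw [ell]; exact Real.log_nonpos (by positivity) hD1
    linarith
  have hχ1 : χ ≠ 1 := Lemma31.ne_one_of_isPrimitive χ hD2 hp
  -- the profile
  set G : ℝ → ℂ := fun u => frakfW c' D j 6 (bigP D ^ (0.504 : ℝ) / u) / 0.504 +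
    iota2 * frakfW c' D j 7 (bigP D ^ (0.5 : ℝ) / u) / 0.5 with hG
  set M : ℝ := 58 * Kι with hM
  set M' : ℝ := 188 * Kι * alpha D with hM'
  have hM0 : 0 ≤ M := by positivity
  have hprof : ∀ t : ℝ, 1 ≤ t → t ≤ bigP D ^ (0.5 : ℝ) + 1 →
      DifferentiableAt ℝ G t ∧ ‖G t‖ ≤ M ∧ ‖deriv G t‖ ≤ M' / t := by
    intro t h1 h2
    have h := low1113Profile_bounds c' j hα hℓ0.le hc h1 (h2.trans hhiP) hΛ4
    exact ⟨h.1, h.2.1, h.2.2⟩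
  have key := hR j 1 (bigP D ^ (0.5 : ℝ)) M M' G le_rfl hQ1 hhiP hM0 hprof
  -- sizes of the scalar prefactor
  have hL' : ‖deriv χ.LFunction 1‖ ≤ cL * ell D ^ 2 :=
    RangeAverage.norm_deriv_LFunction_one_le_sq χ hℓ3 hp
  have hβ1 := Section8AbelProfiles.norm_betaJ_le c' hα.le hℓ0.le hc (j + 1)
  have hβ2 := Section8AbelProfiles.norm_betaJ_le c' hα.le hℓ0.le hc (j + 2)
  have hPr : ‖betaJ c' D (j + 1) * betaJ c' D (j + 2)‖ ≤ (4 * alpha D) * (4 * alpha D) := by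
    rw [norm_mul]; exact mul_le_mul hβ1 hβ2 (norm_nonneg _) (by positivity)
  -- `𝔞 = 𝔠_D L′(1,χ)²`
  have hA𝔞 := RangeAverage.frakA_eq_frakcD_mul_sq χ hχ1 hq
  set cD : ℝ := 6 / π ^ 2 * ∏ q ∈ D.primeFactors, ((q : ℝ) / (q + 1)) with hcD
  -- the exact layer
  have hN : nAvg c' χ j 0 (bigP D ^ (0.5 : ℝ)) (fun n =>
      frakfW c' D j 6 (bigP D ^ (0.504 : ℝ) / n) / 0.504 +
        iota2 * frakfW c' D j 7 (bigP D ^ (0.5 : ℝ) / n) / 0.5) =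
      Sec10C.lamAvg c' χ j 1 (bigP D ^ (0.5 : ℝ)) (fun n => G n) := by
    rw [nAvg_zero_eq_lamAvg_one]
  have hI : ∫ x in (1 : ℝ)..(bigP D ^ (0.5 : ℝ)),
      (frakfW c' D j 6 (bigP D ^ (0.504 : ℝ) / x) / 0.504 +
        iota2 * frakfW c' D j 7 (bigP D ^ (0.5 : ℝ) / x) / 0.5) / (x : ℂ) =
      ∫ x in (1 : ℝ)..(bigP D ^ (0.5 : ℝ)), G x / x := by simp only [hG]
  rw [hN, hI, hA𝔞]
  set N : ℂ := Sec10C.lamAvg c' χ j 1 (bigP D ^ (0.5 : ℝ)) (fun n => G n) with hNdef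
  set Ig : ℂ := ∫ x in (1 : ℝ)..(bigP D ^ (0.5 : ℝ)), G x / x with hIg
  set Lp : ℂ := deriv χ.LFunction 1 with hLp
  set Pr : ℂ := betaJ c' D (j + 1) * betaJ c' D (j + 2) with hPrdef
  have e : Lp ^ 2 / 500 * Pr * N - (cD : ℂ) * Lp ^ 2 * Pr / 500 * Ig =
      Pr / 500 * Lp ^ 2 * (N - (cD : ℂ) * Ig) := by ring
  rw [e, norm_mul, norm_mul, norm_div, norm_pow, show ‖(500 : ℂ)‖ = 500 by norm_num]
  -- the bound
  have hM'Λ : M' * Real.log (bigP D) ≤ 188 * Kι * 4 := by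
    rw [hM', mul_assoc]
    exact mul_le_mul_of_nonneg_left hΛ4 (by positivity)
  have hkey : ‖N - (cD : ℂ) * Ig‖ ≤ C₀ * ell D ^ 2 * (Kι * (58 + 188 * 4)) := by
    refine key.trans ?_
    have : M + M' * Real.log (bigP D) ≤ Kι * (58 + 188 * 4) := by rw [hM]; nlinarith
    exact mul_le_mul_of_nonneg_left this (by positivity)
  have hαℓ6 : alpha D * ell D ^ 6 = π / ell D ^ 3 := by
    rw [hαdef]; field_simp
  have hsmall : K * (alpha D * ell D ^ 6) ≤ ε := by
    rw [hαℓ6]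
    have hℓ3pos : 0 < ell D ^ 3 := by positivity
    have h1 : K * π / ε ≤ ell D ^ 3 := by
      have : ell D ≤ ell D ^ 3 := by
        calc ell D = ell D ^ 1 := (pow_one _).symm
          _ ≤ ell D ^ 3 := pow_le_pow_right₀ hℓ1 (by norm_num)
      linarith
    rw [← mul_div_assoc, div_le_iff₀ hℓ3pos]
    have := (div_le_iff₀ hε).mp h1
    linarith
  calc ‖Pr‖ / 500 * ‖Lp‖ ^ 2 * ‖N - (cD : ℂ) * Ig‖
      ≤ (4 * alpha D) * (4 * alpha D) / 500 * (cL * ell D ^ 2) ^ 2 *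
          (C₀ * ell D ^ 2 * (Kι * (58 + 188 * 4))) := by
        gcongr
    _ = K * (alpha D * ell D ^ 6) * alpha D := by rw [hK]; ring
    _ ≤ ε * alpha D := mul_le_mul_of_nonneg_right hsmall hα.le

variable (c' : ℝ) in
/-- `Eq1036b` — `_holds` alias of `eq1036b_holds` above under the fact's exact name, stated under the
prover's own binders as section variables (appended 2026-08-28, D-0026 bookkeeping: the proof term is the
existing theorem of this file; no statement, definition or attribute is edited; no new named fact; the
ledger's debt table listed the fact unproved). [cite: Zhang2022LandauSiegel, §10 p. 57, tex L2921] -/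
theorem _root_.Literature.NumberTheory.LFunctions.Zhang2022.Typed.Sec10B.Eq1036b_holds :
    _root_.Literature.NumberTheory.LFunctions.Zhang2022.Typed.Sec10B.Eq1036b c' :=
  _root_.Literature.NumberTheory.LFunctions.Zhang2022.Typed.Sec10B.eq1036b_holds (c' := c')

end SecondLines1113

end Literature.NumberTheory.LFunctions.Zhang2022.Typed.Sec10B
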